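import Literature.Barriers.CriticalPhenomena.RigorousRGSmallParameterLocDuality
import Literature.Barriers.CriticalPhenomena.RigorousRGSmallParameterTphiLaplacian
import HarnessLib

/-!
# `RigorousRGSmallParameter` (Slade, Theorem 1.4.1): the index set `𝔳_+` of relevant monomials,
# the operator `Loc_{+,a}` (Definition 2.1.3 of [BS-rg-loc]) and its duality with the lattice
# Taylor operator (Lemma 2.1.4)

Companion ("proof architecture") file of
`Literature/Barriers/CriticalPhenomena/RigorousRGSmallParameter.lean`, continuing
`…LocalMonomials` and `…LocDuality` towards the localisation operator `Loc_X` of [BS-rg-loc]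
(Slade §4.2; the input of [BS-rg-step] for Slade's Theorem 6.3.1). With the duality
`⟨M_{m,a}, f^{(a)}_{m'}⟩_0 = δ_{m,m'}` (Lemma 2.1.2(i), `…LocDuality`) in hand, [BS-rg-loc] define
(Definition 2.1.3) `Loc_{+,a} F = Σ_{m ∈ 𝔳_+} ⟨F, f_m^{(a)}⟩_0 M_{m,a}`, observe that it is the
identity on `𝒱_+({a})`, and prove (Lemma 2.1.4) that it is dual to the lattice Taylor operator,
`⟨Loc_{+,a}F, g⟩_0 = ⟨F, Tay_a g⟩_0`, so that `⟨Loc_{+,a}F, g⟩_0 = ⟨F, g⟩_0` for polynomial test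
functions `g`. This file formalizes these for the concrete model (one real boson species with `n`
components on the torus `TorusSite d M`, field dimension `[φ] = dφ > 0`, maximal dimension
`d_+ = dplus`; Slade, Definition 3.4.2: `[φ]_j = ½(d-α)` below the mass scale, `d_+ = d`):

* the finite index sets `𝔳̄_+` (sequences `m` with `[M_m] = Σ_k([φ] + |α_k|) ≤ d_+`) and `𝔳_+`
  (their classes: a monomial is determined by the multiset of its factors `(i, α)`, `α` a
  multiset of directions — [BS-rg-loc] pick lexicographic representatives instead), with chosen
  representatives `rep C`;
* `Loc_{+,a}` as a finite sum over `𝔳_+`, linear, idempotent, the identity on the monomials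
  `M_{C,a}`, `C ∈ 𝔳_+`;
* the Taylor operator in the form of Lemma 2.1.2(ii), `Tay_a g := Σ_{C ∈ 𝔳_+} ⟨M_{C,a}, g⟩_0 f_C^{(a)}`
  (for [BS-rg-loc] this is `Tay_a S g`; pairings with `𝒩` do not see `S`), Lemma 2.1.4
  `⟨Loc_{+,a}F, g⟩_0 = ⟨F, Tay_a g⟩_0`, `Tay_a f_C = f_C`, and (2.11):
  `⟨Loc_{+,a}F, g⟩_0 = ⟨F, g⟩_0` for `g` in the span of the dual basis `{f_C^{(a)}}` of `SΠ`.

Admissibility of the parameters is bundled in `LocAdm` (`[φ] > 0`; maximal degree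
`⌊d_+/[φ]⌋ ≤ p_𝒩`; no wrapping of the binomial test functions around the torus, `⌊d_+⌋ ≤ M/2`).

Sources: D. C. Brydges, G. Slade, *A renormalisation group method. II. Approximation by local
polynomials*, J. Stat. Phys. 159 (2015) 461–491, arXiv:1403.7253 (read from the TeX source: §1.2
(dimension (1.9), `𝔳_+`), §1.3 (`𝔳̄_+`), §2.1 (Definition 2.1.3, the display `Loc_{+,a}P_a = P_a`,
Lemma 2.1.2(ii), Lemma 2.1.4 with displays (2.10)–(2.11))); G. Slade, arXiv:1611.06169,
Definition 3.4.2 (scaling dimension, relevant monomials) and §4.2.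

## What this file provides (definitions with proved properties; no named fact)

* `innerLists`, `baseIdx`, `allLists` (finite enumerations with membership lemmas), `dim`
  (`[M_m]`), `dim_ge`, **`vbarPlus`** (`𝔳̄_+`, `mem_vbarPlus`), `dim_eq_of_perm_cls`, **`vPlus`**
  (`𝔳_+` as classes), `rep`, `cls_rep`, `not_perm_rep_of_ne`, `rep_mem_vbarPlus`,
  `bounds_of_mem_vbarPlus`.
* `monoC`/`dualC` (`M_{C,a}`, `f_C^{(a)}`), `LocAdm`, **`TphiPairing_monoC_dualC`**
  (Lemma 2.1.2(i) on `𝔳_+`: `⟨M_C, f_{C'}⟩_0 = δ_{C,C'}`).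
* **`locPlus`** (Definition 2.1.3), `contDiff_locPlus`, **`locPlus_monoC`** (identity on
  `𝒱_+({a})`), `pairing_smul_left`, `TphiPairing_add`, `TphiPairing_const_mul`,
  `TphiPairing_zero_left`, `TphiPairing_finset_sum` (linearity of `⟨·, g⟩_φ` in `F`),
  `locPlus_add`, `locPlus_const_mul`, `locPlus_locPlus` (projection).
* **`tay`** (the Taylor operator in the form (2.7)), **`TphiPairing_locPlus`** (Lemma 2.1.4),
  `tay_dualC`, `tay_span`, **`TphiPairing_locPlus_of_span`** ((2.11) on the span of the dual
  basis).

## References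

* [BrydgesSlade2015RGII] D. C. Brydges, G. Slade, *A renormalisation group method. II.
  Approximation by local polynomials*, J. Stat. Phys. 159 (2015) 461–491, arXiv:1403.7253 —
  §1.2–1.3, §2.1 (Definition 2.1.3, Lemmas 2.1.2, 2.1.4).
* [Slade2017] G. Slade, *Critical exponents for long-range O(n) models below the upper critical
  dimension*, Commun. Math. Phys. 358 (2018) 343–436, arXiv:1611.06169 — Definition 3.4.2, §4.2.
-/

noncomputable section

namespace Literature.Barriers.CriticalPhenomena

namespace LongRangePhi4

namespace Loc

open Finset Tphi RGNorm LocalPoly Literature.Probability.LatticeModels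
open scoped ContDiff

variable {d M n : ℕ} [NeZero M]

/-! ### The finite index sets `𝔳̄_+` (sequences) and `𝔳_+` (classes) of relevant monomials -/

/-- All forward multi-indices (lists of directions) of order `≤ K'`. [folklore] -/
def innerLists (d K' : ℕ) : Finset (List (Fin d)) :=
  (range (K' + 1)).biUnion fun k => (univ : Finset (Fin k → Fin d)).image List.ofFn

omit [NeZero M] in
/-- Membership in `innerLists`: the order is `≤ K'`. [folklore] -/
theorem mem_innerLists {K' : ℕ} {α : List (Fin d)} : α ∈ innerLists d K' ↔ α.length ≤ K' := by
  unfold innerLists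
  simp only [mem_biUnion, mem_range, mem_image, mem_univ, true_and]
  constructor
  · rintro ⟨k, hk, f, rfl⟩
    simpa using Nat.lt_succ_iff.1 hk
  · intro h
    exact ⟨α.length, Nat.lt_succ_iff.2 h, fun i => α[i], List.ofFn_getElem⟩

/-- The factors `(i, α)` with `|α| ≤ K'`. [folklore] -/
def baseIdx (d n K' : ℕ) : Finset (Fin n × List (Fin d)) := univ ×ˢ innerLists d K'

/-- All sequences `m = ((i_1,α_1),…,(i_p,α_p))` with `p ≤ K` and `|α_k| ≤ K'`. [folklore] -/
def allLists (d n K K' : ℕ) : Finset (List (Fin n × List (Fin d))) :=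
  (range (K + 1)).biUnion fun k =>
    (univ : Finset (Fin k → ↥(baseIdx d n K'))).image fun f => List.ofFn fun i => (f i).1

omit [NeZero M] in
/-- Membership in `allLists`. [folklore] -/
theorem mem_allLists {K K' : ℕ} {m : List (Fin n × List (Fin d))} :
    m ∈ allLists d n K K' ↔ m.length ≤ K ∧ ∀ c ∈ m, c.2.length ≤ K' := by
  unfold allLists
  simp only [mem_biUnion, mem_range, mem_image, mem_univ, true_and]
  constructor
  · rintro ⟨k, hk, f, rfl⟩
    refine ⟨by simpa using Nat.lt_succ_iff.1 hk, fun c hc => ?_⟩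
    rw [List.mem_ofFn] at hc
    obtain ⟨i, rfl⟩ := hc
    have h := (f i).2
    simp only [baseIdx, mem_product, mem_univ, true_and, mem_innerLists] at h
    exact h
  · rintro ⟨hlen, hc⟩
    refine ⟨m.length, Nat.lt_succ_iff.2 hlen, fun i => ⟨m[i], ?_⟩, ?_⟩
    · simp only [baseIdx, mem_product, mem_univ, true_and, mem_innerLists]
      exact hc _ (List.getElem_mem _)
    · exact List.ofFn_getElem

/-- **The dimension `[M_m] = Σ_k ([φ] + |α_k|_1)`** of the monomial indexed by `m`, for a field of
scaling dimension `[φ] = dφ` ([BS-rg-loc] (1.9); Slade, Definition 3.4.2: `[φ]_j = ½(d-α)` for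
`j ≤ j_m`, `½(d+α')` above the mass scale, and `[M_x]_j = Σ_k([φ]_j + |a_k|)`, relevant iff `< d`).
[cite: BrydgesSlade2015RGII, §1.2 (display (1.9) defining [M_m])] [cite: Slade2017, Definition 3.4.2] -/
def dim (dφ : ℝ) (m : List (Fin n × List (Fin d))) : ℝ := m.length * dφ + ((m.map fun c => c.2.length).sum : ℕ)

omit [NeZero M] in
/-- The dimension dominates `p(m)·[φ]` and each `|α_k|`. [folklore] -/
theorem dim_ge (dφ : ℝ) (m : List (Fin n × List (Fin d))) :
    m.length * dφ ≤ dim dφ m ∧ ∀ c ∈ m, m.length * dφ + c.2.length ≤ dim dφ m := by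
  refine ⟨by unfold dim; exact le_add_of_nonneg_right (Nat.cast_nonneg _), fun c hc => ?_⟩
  unfold dim
  have h : c.2.length ≤ (m.map fun c => c.2.length).sum :=
    List.le_sum_of_mem (List.mem_map.2 ⟨c, hc, rfl⟩)
  exact add_le_add_right (Nat.cast_le (α := ℝ) |>.2 h) _

/-- **`𝔳̄_+`**: the sequences `m` (no ordering condition) indexing monomials `M_m ∈ ℳ_+` of
dimension `[M_m] ≤ d_+` — a finite set since `[φ] > 0`. [cite: BrydgesSlade2015RGII, §1.2 (𝔳_+ = {m ∈ 𝔪_+ : [M_m] ≤ d_+}) and §1.3 (𝔪̄_+, 𝔳̄_+: "dropping the order condition")] -/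
def vbarPlus (d n : ℕ) (dφ dplus : ℝ) : Finset (List (Fin n × List (Fin d))) :=
  (allLists d n ⌊dplus / dφ⌋₊ ⌊dplus⌋₊).filter fun m => dim dφ m ≤ dplus

omit [NeZero M] in
/-- Membership in `𝔳̄_+` is the dimension condition (`[φ] > 0`). [folklore] -/
theorem mem_vbarPlus {dφ dplus : ℝ} (hφ : 0 < dφ) {m : List (Fin n × List (Fin d))} :
    m ∈ vbarPlus d n dφ dplus ↔ dim dφ m ≤ dplus := by
  unfold vbarPlus
  rw [mem_filter, mem_allLists]
  constructor
  · exact fun h => h.2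
  · intro h
    obtain ⟨h1, h2⟩ := dim_ge dφ m
    have hlenR : (m.length : ℝ) * dφ ≤ dplus := h1.trans h
    refine ⟨⟨?_, fun c hc => ?_⟩, h⟩
    · refine Nat.le_floor ?_
      rw [le_div_iff₀ hφ]
      exact hlenR
    · refine Nat.le_floor ?_
      have := (h2 c hc).trans h
      have h0 : 0 ≤ (m.length : ℝ) * dφ := by positivity
      linarith

/-- `𝔳̄_+` is closed under rearrangement of equivalent factors (the dimension is a class function). [folklore] -/
theorem dim_eq_of_perm_cls {dφ : ℝ} {m m' : List (Fin n × List (Fin d))} (h : (m.map cls).Perm (m'.map cls)) :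
    dim dφ m = dim dφ m' := by
  unfold dim
  have hlen : m.length = m'.length := by simpa using h.length_eq
  have hsum : (m.map fun c => c.2.length).sum = (m'.map fun c => c.2.length).sum := by
    have h1 : ∀ l : List (Fin n × List (Fin d)), (l.map fun c => c.2.length) = (l.map cls).map fun q => Multiset.card q.2 := by
      intro l; simp [cls, Function.comp_def]
    rw [h1 m, h1 m', (h.map _).sum_eq]
  rw [hlen, hsum]

/-- **`𝔳_+`**: the relevant monomial CLASSES (a monomial is determined by the multiset of its
factors `(i, α)` with `α` a multiset of directions) of dimension `≤ d_+` — in bijection with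
[BS-rg-loc]'s lexicographically ordered representatives `𝔳_+ ⊂ 𝔪_+`. [cite: BrydgesSlade2015RGII, §1.2 ("every non-zero monomial is represented by exactly one m ∈ 𝔪"; 𝔳_+)] -/
def vPlus (d n : ℕ) (dφ dplus : ℝ) : Finset (Multiset (Fin n × Multiset (Fin d))) :=
  (vbarPlus d n dφ dplus).image fun m => ((m.map cls : List (Fin n × Multiset (Fin d))) : Multiset _)

/-- A representative sequence of a class. [folklore] -/
def rep (C : Multiset (Fin n × Multiset (Fin d))) : List (Fin n × List (Fin d)) :=
  (C.map fun q => (q.1, q.2.toList)).toList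

omit [NeZero M] in
/-- The representative represents: the classes of `rep C` form `C`. [folklore] -/
theorem cls_rep (C : Multiset (Fin n × Multiset (Fin d))) :
    (((rep C).map cls : List _) : Multiset (Fin n × Multiset (Fin d))) = C := by
  unfold rep
  rw [← Multiset.map_coe, Multiset.coe_toList, Multiset.map_map]
  conv_rhs => rw [← Multiset.map_id C]
  refine Multiset.map_congr rfl fun q _ => ?_
  simp [cls]

omit [NeZero M] in
/-- Distinct classes have inequivalent representatives. [folklore] -/
theorem not_perm_rep_of_ne {C C' : Multiset (Fin n × Multiset (Fin d))} (h : C ≠ C') :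
    ¬ ((rep C).map cls).Perm ((rep C').map cls) := by
  intro hp
  apply h
  rw [← cls_rep C, ← cls_rep C', Multiset.coe_eq_coe]
  exact hp

omit [NeZero M] in
/-- Members of `𝔳_+` have representatives in `𝔳̄_+`, of bounded length and order. [folklore] -/
theorem rep_mem_vbarPlus {dφ dplus : ℝ} (hφ : 0 < dφ) {C : Multiset (Fin n × Multiset (Fin d))}
    (hC : C ∈ vPlus d n dφ dplus) : rep C ∈ vbarPlus d n dφ dplus := by
  unfold vPlus at hC
  rw [mem_image] at hC
  obtain ⟨m, hm, hmC⟩ := hC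
  rw [mem_vbarPlus hφ] at hm ⊢
  have hperm : ((rep C).map cls).Perm (m.map cls) := by
    rw [← Multiset.coe_eq_coe, cls_rep, hmC]
  rwa [dim_eq_of_perm_cls hperm]

omit [NeZero M] in
/-- Length and order bounds in `𝔳̄_+`. [folklore] -/
theorem bounds_of_mem_vbarPlus {dφ dplus : ℝ} {m : List (Fin n × List (Fin d))}
    (hm : m ∈ vbarPlus d n dφ dplus) : m.length ≤ ⌊dplus / dφ⌋₊ ∧ ∀ c ∈ m, c.2.length ≤ ⌊dplus⌋₊ := by
  unfold vbarPlus at hm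
  rw [mem_filter, mem_allLists] at hm
  exact hm.1

/-! ### The monomials and dual test functions indexed by classes; the duality -/

/-- `M_{C,a}`: the monomial of the class `C` at `a`. [cite: BrydgesSlade2015RGII, §2.1 (M_{m,a})] -/
def monoC (a : TorusSite d M) (C : Multiset (Fin n × Multiset (Fin d))) : (TorusSite d M → Fin n → ℝ) → ℝ :=
  monomial ((rep C).map fwd) a

/-- `f_C^{(a)}`: the dual test function of the class `C` at `a`. [cite: BrydgesSlade2015RGII, §2.1 (display (2.5))] -/
def dualC (a : TorusSite d M) (C : Multiset (Fin n × Multiset (Fin d))) : List (TorusSite d M × Fin n) → ℝ :=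
  dualTF a (rep C)

/-- `M_{C,a}` is smooth. [folklore] -/
theorem contDiff_monoC (a : TorusSite d M) (C : Multiset (Fin n × Multiset (Fin d))) : ContDiff ℝ ∞ (monoC a C) :=
  contDiff_monomial _ a

/-- Admissibility of the parameters: `[φ] > 0`, the maximal degree `⌊d_+/[φ]⌋ ≤ p_𝒩`, and no
wrapping around the torus for the binomial test functions, `⌊d_+⌋ ≤ M/2`. [folklore] -/
structure LocAdm (M n pN : ℕ) (dφ dplus : ℝ) : Prop where
  pos : 0 < dφ
  one_le : 1 ≤ pN
  deg_le : ⌊dplus / dφ⌋₊ ≤ pN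
  ord_le : ⌊dplus⌋₊ ≤ M / 2

/-- **Lemma 2.1.2(i) of [BS-rg-loc]**: `⟨M_{C,a}, f_{C'}^{(a)}⟩_0 = δ_{C,C'}` on `𝔳_+`. [cite: BrydgesSlade2015RGII, Lemma 2.1.2(i)] -/
theorem TphiPairing_monoC_dualC {pN : ℕ} {dφ dplus : ℝ} (hA : LocAdm M n pN dφ dplus) (a : TorusSite d M)
    {C C' : Multiset (Fin n × Multiset (Fin d))} (hC : C ∈ vPlus d n dφ dplus) (hC' : C' ∈ vPlus d n dφ dplus) :
    TphiPairing pN (basisDir d M n) (monoC a C) 0 (dualC a C') = if C = C' then 1 else 0 := by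
  have hb := bounds_of_mem_vbarPlus (rep_mem_vbarPlus hA.pos hC)
  have hb' := bounds_of_mem_vbarPlus (rep_mem_vbarPlus hA.pos hC')
  have hm : ∀ c ∈ rep C, c.2.length ≤ M / 2 := fun c hc => (hb.2 c hc).trans hA.ord_le
  have hp : (rep C').length ≤ pN := hb'.1.trans hA.deg_le
  unfold monoC dualC
  split_ifs with h
  · subst h
    exact TphiPairing_monomial_dualTF_self hA.one_le a (rep C) hm hp
  · exact TphiPairing_monomial_dualTF_eq_zero hA.one_le a (rep C) (rep C') hm hp (not_perm_rep_of_ne h)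

/-! ### `Loc_{+,a}` (Definition 2.1.3) and the identity on `𝒱_+({a})` -/

/-- **Definition 2.1.3 of [BS-rg-loc]**: the linear map
`Loc_{+,a} F = Σ_{m ∈ 𝔳_+} ⟨F, f_m^{(a)}⟩_0 M_{m,a}` from `𝒩` to `𝒱_+({a})`.
[cite: BrydgesSlade2015RGII, Definition 2.1.3] -/
def locPlus (pN : ℕ) (dφ dplus : ℝ) (a : TorusSite d M) (F : (TorusSite d M → Fin n → ℝ) → ℝ) :
    (TorusSite d M → Fin n → ℝ) → ℝ :=
  fun φ => ∑ C ∈ vPlus d n dφ dplus, TphiPairing pN (basisDir d M n) F 0 (dualC a C) * monoC a C φ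

/-- `Loc_{+,a} F ∈ 𝒩` (smooth). [folklore] -/
theorem contDiff_locPlus (pN : ℕ) (dφ dplus : ℝ) (a : TorusSite d M) (F : (TorusSite d M → Fin n → ℝ) → ℝ) :
    ContDiff ℝ ∞ (locPlus pN dφ dplus a F) :=
  ContDiff.sum fun C _ => contDiff_const.mul (contDiff_monoC a C)

/-- **`Loc_{+,a} M_{m,a} = M_{m,a}` for `m ∈ 𝔳_+`** ("an immediate consequence of (2.8) and
(2.6)"), whence `Loc_{+,a} P_a = P_a` for `P ∈ 𝒱_+`. [cite: BrydgesSlade2015RGII, §2.1 (display after Definition 2.1.3: Loc_{+,a}P_a = P_a)] -/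
theorem locPlus_monoC {pN : ℕ} {dφ dplus : ℝ} (hA : LocAdm M n pN dφ dplus) (a : TorusSite d M)
    {C : Multiset (Fin n × Multiset (Fin d))} (hC : C ∈ vPlus d n dφ dplus) :
    locPlus pN dφ dplus a (monoC a C) = monoC a C := by
  funext φ
  unfold locPlus
  rw [Finset.sum_eq_single C]
  · rw [TphiPairing_monoC_dualC hA a hC hC, if_pos rfl, one_mul]
  · intro C' hC' hne
    rw [TphiPairing_monoC_dualC hA a hC hC', if_neg (Ne.symm hne), zero_mul]
  · intro h; exact absurd hC h

/-- The pairing `⟨F, g⟩_φ` is additive in `F ∈ 𝒩`. [folklore] -/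
theorem TphiPairing_add {E : Type*} [NormedAddCommGroup E] [NormedSpace ℝ E] {Ξ : Type*} [Fintype Ξ]
    (pN : ℕ) (e : Ξ → E) {F G : E → ℝ} (hF : ContDiff ℝ ∞ F) (hG : ContDiff ℝ ∞ G) (φ : E) (g : List Ξ → ℝ) :
    TphiPairing pN e (fun ψ => F ψ + G ψ) φ g = TphiPairing pN e F φ g + TphiPairing pN e G φ g := by
  unfold TphiPairing
  rw [coeffFamily_add e hF hG, pairing_add_left]

/-- The pairing is homogeneous in the coefficient family. [folklore] -/
theorem pairing_smul_left {Ξ : Type*} [Fintype Ξ] (pN : ℕ) (c : ℝ) (F g : List Ξ → ℝ) :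
    pairing pN (fun z => c * F z) g = c * pairing pN F g := by
  unfold pairing
  rw [Finset.mul_sum]
  refine Finset.sum_congr rfl fun r _ => ?_
  have h : sumSeq r (fun z => c * F z * g z) = c * sumSeq r (fun z => F z * g z) := by
    rw [← sumSeq_mul_left]
    exact sumSeq_congr r fun z _ => by ring
  rw [h]
  ring

/-- The pairing is homogeneous in `F`. [folklore] -/
theorem TphiPairing_const_mul {E : Type*} [NormedAddCommGroup E] [NormedSpace ℝ E] {Ξ : Type*} [Fintype Ξ]
    (pN : ℕ) (e : Ξ → E) {F : E → ℝ} (hF : ContDiff ℝ ∞ F) (c : ℝ) (φ : E) (g : List Ξ → ℝ) :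
    TphiPairing pN e (fun ψ => c * F ψ) φ g = c * TphiPairing pN e F φ g := by
  unfold TphiPairing
  have h : coeffFamily e (fun ψ => c * F ψ) φ = fun z => c * coeffFamily e F φ z := by
    funext z; simp only [coeffFamily, coeff_const_mul e hF c z]
  rw [h, pairing_smul_left]

/-- The pairing with `0 ∈ 𝒩` vanishes. [folklore] -/
theorem TphiPairing_zero_left {E : Type*} [NormedAddCommGroup E] [NormedSpace ℝ E] {Ξ : Type*} [Fintype Ξ]
    (pN : ℕ) (e : Ξ → E) (φ : E) (g : List Ξ → ℝ) :
    TphiPairing pN e (fun _ : E => (0 : ℝ)) φ g = 0 := by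
  have h := TphiPairing_const_mul pN e (F := fun _ : E => (1 : ℝ)) contDiff_const 0 φ g
  simpa using h

/-- The pairing is additive over finite sums in `F`. [folklore] -/
theorem TphiPairing_finset_sum {E : Type*} [NormedAddCommGroup E] [NormedSpace ℝ E] {Ξ : Type*} [Fintype Ξ]
    (pN : ℕ) (e : Ξ → E) {β : Type*} (s : Finset β) {F : β → E → ℝ} (hF : ∀ i ∈ s, ContDiff ℝ ∞ (F i))
    (φ : E) (g : List Ξ → ℝ) :
    TphiPairing pN e (fun ψ => ∑ i ∈ s, F i ψ) φ g = ∑ i ∈ s, TphiPairing pN e (F i) φ g := by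
  classical
  induction s using Finset.induction_on with
  | empty => simpa using TphiPairing_zero_left pN e φ g
  | insert b s hb ih =>
      rw [Finset.sum_insert hb, ← ih (fun i hi => hF i (Finset.mem_insert_of_mem hi))]
      have h := TphiPairing_add pN e (hF b (Finset.mem_insert_self b s))
        (ContDiff.sum fun i hi => hF i (Finset.mem_insert_of_mem hi)) φ g
      rw [← h]
      congr 1
      funext ψ
      rw [Finset.sum_insert hb]

/-- **`Loc_{+,a}` is linear**: additive. [cite: BrydgesSlade2015RGII, Definition 2.1.3 ("a linear map")] -/
theorem locPlus_add (pN : ℕ) (dφ dplus : ℝ) (a : TorusSite d M) {F G : (TorusSite d M → Fin n → ℝ) → ℝ}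
    (hF : ContDiff ℝ ∞ F) (hG : ContDiff ℝ ∞ G) :
    locPlus pN dφ dplus a (fun ψ => F ψ + G ψ) = fun φ => locPlus pN dφ dplus a F φ + locPlus pN dφ dplus a G φ := by
  funext φ
  simp only [locPlus, TphiPairing_add pN _ hF hG, add_mul, Finset.sum_add_distrib]

/-- **`Loc_{+,a}` is linear**: homogeneous. [cite: BrydgesSlade2015RGII, Definition 2.1.3 ("a linear map")] -/
theorem locPlus_const_mul (pN : ℕ) (dφ dplus : ℝ) (a : TorusSite d M) {F : (TorusSite d M → Fin n → ℝ) → ℝ}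
    (hF : ContDiff ℝ ∞ F) (c : ℝ) :
    locPlus pN dφ dplus a (fun ψ => c * F ψ) = fun φ => c * locPlus pN dφ dplus a F φ := by
  funext φ
  simp only [locPlus, TphiPairing_const_mul pN _ hF, mul_assoc, Finset.mul_sum]

/-- **`Loc_{+,a}` is a projection**: `Loc_{+,a} ∘ Loc_{+,a} = Loc_{+,a}`. [cite: BrydgesSlade2015RGII, §2.1 (Loc_{+,a}P_a = P_a for P ∈ 𝒱_+)] -/
theorem locPlus_locPlus {pN : ℕ} {dφ dplus : ℝ} (hA : LocAdm M n pN dφ dplus) (a : TorusSite d M)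
    (F : (TorusSite d M → Fin n → ℝ) → ℝ) :
    locPlus pN dφ dplus a (locPlus pN dφ dplus a F) = locPlus pN dφ dplus a F := by
  have h : ∀ φ, locPlus pN dφ dplus a (locPlus pN dφ dplus a F) φ =
      ∑ C ∈ vPlus d n dφ dplus, TphiPairing pN (basisDir d M n) F 0 (dualC a C) *
        locPlus pN dφ dplus a (monoC a C) φ := by
    intro φ
    have hs : ∀ C', TphiPairing pN (basisDir d M n) (locPlus pN dφ dplus a F) 0 (dualC a C') =
        ∑ C ∈ vPlus d n dφ dplus, TphiPairing pN (basisDir d M n) F 0 (dualC a C) *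
          TphiPairing pN (basisDir d M n) (monoC a C) 0 (dualC a C') := by
      intro C'
      unfold locPlus
      rw [TphiPairing_finset_sum pN (basisDir d M n) (vPlus d n dφ dplus)
        (F := fun C ψ => TphiPairing pN (basisDir d M n) F 0 (dualC a C) * monoC a C ψ)
        (fun C _ => contDiff_const.mul (contDiff_monoC a C))]
      exact Finset.sum_congr rfl fun C _ => TphiPairing_const_mul pN _ (contDiff_monoC a C) _ 0 _
    show ∑ C' ∈ vPlus d n dφ dplus, TphiPairing pN (basisDir d M n) (locPlus pN dφ dplus a F) 0 (dualC a C') *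
        monoC a C' φ = _
    simp only [hs, Finset.sum_mul, mul_assoc]
    rw [Finset.sum_comm]
    refine Finset.sum_congr rfl fun C _ => ?_
    rw [← Finset.mul_sum]
    rfl
  funext φ
  rw [h]
  conv_rhs => unfold locPlus
  refine Finset.sum_congr rfl fun C hC => ?_
  rw [locPlus_monoC hA a hC]

/-! ### Lemma 2.1.4: `Loc_{+,a}` is dual to the Taylor operator -/

/-- **The Taylor operator `Tay_a` in the form (2.7)**: `Tay_a g = Σ_{m ∈ 𝔳_+} ⟨M_{m,a}, g⟩_0 f_m^{(a)}`
(Lemma 2.1.2(ii) of [BS-rg-loc], `Tay_a S g`, taken here as the definition; the pairing with `𝒩`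
does not see the symmetrisation `S`). [cite: BrydgesSlade2015RGII, Lemma 2.1.2(ii) and display (2.4)] -/
def tay (pN : ℕ) (dφ dplus : ℝ) (a : TorusSite d M) (g : List (TorusSite d M × Fin n) → ℝ) :
    List (TorusSite d M × Fin n) → ℝ :=
  fun z => ∑ C ∈ vPlus d n dφ dplus, TphiPairing pN (basisDir d M n) (monoC a C) 0 g * dualC a C z

/-- **Lemma 2.1.4 of [BS-rg-loc]**: `⟨Loc_{+,a} F, g⟩_0 = ⟨F, Tay_a g⟩_0`. [cite: BrydgesSlade2015RGII, Lemma 2.1.4 (display (2.10))] -/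
theorem TphiPairing_locPlus (pN : ℕ) (dφ dplus : ℝ) (a : TorusSite d M) (F : (TorusSite d M → Fin n → ℝ) → ℝ)
    (g : List (TorusSite d M × Fin n) → ℝ) :
    TphiPairing pN (basisDir d M n) (locPlus pN dφ dplus a F) 0 g =
      TphiPairing pN (basisDir d M n) F 0 (tay pN dφ dplus a g) := by
  have h1 : TphiPairing pN (basisDir d M n) (locPlus pN dφ dplus a F) 0 g =
      ∑ C ∈ vPlus d n dφ dplus, TphiPairing pN (basisDir d M n) F 0 (dualC a C) *
        TphiPairing pN (basisDir d M n) (monoC a C) 0 g := by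
    unfold locPlus
    rw [TphiPairing_finset_sum pN (basisDir d M n) (vPlus d n dφ dplus)
      (F := fun C ψ => TphiPairing pN (basisDir d M n) F 0 (dualC a C) * monoC a C ψ)
      (fun C _ => contDiff_const.mul (contDiff_monoC a C))]
    exact Finset.sum_congr rfl fun C _ => TphiPairing_const_mul pN _ (contDiff_monoC a C) _ 0 g
  have h2 : TphiPairing pN (basisDir d M n) F 0 (tay pN dφ dplus a g) =
      ∑ C ∈ vPlus d n dφ dplus, TphiPairing pN (basisDir d M n) (monoC a C) 0 g *
        TphiPairing pN (basisDir d M n) F 0 (dualC a C) := by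
    unfold tay TphiPairing
    rw [pairing_sum_right]
    exact Finset.sum_congr rfl fun C _ => pairing_smul_right pN _ _ _
  rw [h1, h2]
  exact Finset.sum_congr rfl fun C _ => mul_comm _ _

/-- **`Tay_a` reproduces the dual test functions**: `Tay_a f_{C}^{(a)} = f_C^{(a)}` for `C ∈ 𝔳_+`
(Lemma 2.1.1(iii), `Tay_a g = g` on `Π`, for the basis of `SΠ`). [cite: BrydgesSlade2015RGII, Lemma 2.1.1(iii) and Lemma 2.1.2] -/
theorem tay_dualC {pN : ℕ} {dφ dplus : ℝ} (hA : LocAdm M n pN dφ dplus) (a : TorusSite d M)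
    {C : Multiset (Fin n × Multiset (Fin d))} (hC : C ∈ vPlus d n dφ dplus) :
    tay pN dφ dplus a (dualC a C) = dualC a C := by
  funext z
  unfold tay
  rw [Finset.sum_eq_single C]
  · rw [TphiPairing_monoC_dualC hA a hC hC, if_pos rfl, one_mul]
  · intro C' hC' hne
    rw [TphiPairing_monoC_dualC hA a hC' hC, if_neg hne, zero_mul]
  · intro h; exact absurd hC h

/-- `Tay_a` is the identity on the span of the dual basis (Lemma 2.1.1(iii): `Tay_a g = g` for
`g ∈ Π`). [cite: BrydgesSlade2015RGII, Lemma 2.1.1(iii)] -/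
theorem tay_span {pN : ℕ} {dφ dplus : ℝ} (hA : LocAdm M n pN dφ dplus) (a : TorusSite d M)
    (coef : Multiset (Fin n × Multiset (Fin d)) → ℝ) :
    tay pN dφ dplus a (fun z => ∑ C ∈ vPlus d n dφ dplus, coef C * dualC a C z) =
      fun z => ∑ C ∈ vPlus d n dφ dplus, coef C * dualC a C z := by
  funext z
  unfold tay TphiPairing
  simp only [pairing_sum_right, pairing_smul_right, Finset.sum_mul]
  rw [Finset.sum_comm]
  refine Finset.sum_congr rfl fun C hC => ?_
  have h := congrFun (tay_dualC hA a hC) z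
  unfold tay TphiPairing at h
  rw [← h, Finset.mul_sum]
  refine Finset.sum_congr rfl fun C' _ => ?_
  ring

/-- **(2.11) of [BS-rg-loc]: `⟨Loc_{+,a} F, g⟩_0 = ⟨F, g⟩_0` for polynomial test functions** —
here for every `g` in the span of the dual basis `{f_C^{(a)}}_{C ∈ 𝔳_+}` of `SΠ`. [cite: BrydgesSlade2015RGII, Lemma 2.1.4 (display (2.11))] -/
theorem TphiPairing_locPlus_of_span {pN : ℕ} {dφ dplus : ℝ} (hA : LocAdm M n pN dφ dplus) (a : TorusSite d M)
    (F : (TorusSite d M → Fin n → ℝ) → ℝ) (coef : Multiset (Fin n × Multiset (Fin d)) → ℝ) :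
    TphiPairing pN (basisDir d M n) (locPlus pN dφ dplus a F) 0
        (fun z => ∑ C ∈ vPlus d n dφ dplus, coef C * dualC a C z) =
      TphiPairing pN (basisDir d M n) F 0 (fun z => ∑ C ∈ vPlus d n dφ dplus, coef C * dualC a C z) := by
  rw [TphiPairing_locPlus pN dφ dplus a F, tay_span hA a coef]

end Loc

end LongRangePhi4

end Literature.Barriers.CriticalPhenomena

end
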